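import Summits.AtomisticToContinuum.FouriersLaw.Theses.StaticAbelianSqueeze
import Summits.AtomisticToContinuum.FouriersLaw.Theses.LatticeLandauDamping
import Summits.AtomisticToContinuum.FouriersLaw.Theorems.CageBudgetFeketeHeatVarianceCalculus
import Summits.AtomisticToContinuum.FouriersLaw.Theorems.EmbeddedDrudeMourreAbelOfSpectralDensity
import Literature.MathematicalPhysics.KineticTheory.InfiniteChainDLRUniqueness
import HarnessLib

/-!
# Stub `stub_bulkAbelRegularPair` (M2) of line `Sketch`, crux `StaticAbelianSqueeze.UniformAbelianRegularity`
(item stmt-AtomisticToContinuum-13416) — REDUCTION TO EXISTING ITEMS (`--supports` file proving the registered glue stubs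
`stub_bulkAbelRegularPairOfAbelGreenKubo` and `stub_bulkAbelRegularPairOfWindow`; closes nothing; written by a wave-4 stub-worker of the lead c1)

M2 asks, for EVERY regular pair `(μT, D)` of `pinnedChain ω₂ lam β γ` (all `> 0`) at `T > 0` (DLR Gibbs, shift-invariant,
superstable, carrier `⊆ bmGood`, `μT`-preserving, absolutely convergent summed current correlations), that the Abel means
`∫₀^∞ e^{−νt} D.currentCorrelation μT t dt` converge as `ν ↓ 0` — bulk Abelian Green–Kubo EXISTENCE, open-problem class.

The mathematical point settled here, from LANDED facts only: **all regular pairs have one and the same current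
autocorrelation function** (`currentCorrelation_eq_of_isShiftInvariant`):
* DLR uniqueness in the shift-invariant class (`OscillatorChain.pinnedChain_eq_of_isChainGibbsMeasure_of_isShiftInvariant`,
  Literature `InfiniteChainDLRUniqueness`; Georgii Thm 10.25): two shift-invariant DLR states at `T` are equal;
* flow rigidity (`HeatVarianceCalculus.CanonicalRigidity.flow_ae_eq_canonical`, Theorems/CageBudgetFeketeHeatVarianceCalculus,
  item 15772): every dynamics preserving the shift-invariant DLR state is `μT`-a.e., at all times, the canonical
  Buttà–Marchioro dynamics of `OscillatorChain.exists_bmDynamics`; hence `integral_congr_ae` + `tsum_congr`.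
Superstability, the carrier clause and absolute convergence of the regular pair are not even used.

Consequences (the deliverable):
* `bulkAbelRegularPair_of_shiftInvariantWitness` — ONE shift-invariant DLR pair with convergent Abel means gives M2 for every
  regular pair;
* `stub_bulkAbelRegularPairOfAbelGreenKubo` — M2 from the target item `LatticeLandauDamping.AbelGreenKubo` (stmt-14010, open) plus
  the witness seam `stub_witnessShiftInvariant` of the twin cruxes (Cruxes/AbelThermodynamicLimit/Lines/SketchIdeator2.lean,
  VERBATIM as hypothesis `hSI`; needed because `AbelGreenKubo`'s witness state is bare DLR, and bare DLR admits non-tight states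
  that no tree fact links to the regular one);
* `stub_bulkAbelRegularPairOfWindow` — M2 from `LatticeLandauDamping.WindowDecomposition` (stmt-14011) ∧ `NoDrudeWeight`
  (stmt-14012) with NO seam (their witness is shift-invariant by construction; `PositiveDensity` is not needed for existence),
  via the landed Poisson-kernel lemma `latticeLandauDamping_abelOfSpectralDensity_proof` (stmt-12598).
-/

noncomputable section

namespace Summit.AtomisticToContinuum.FouriersLaw.Theorems.UniformAbelianRegularity.ZeroMeanDyadicSplice

open MeasureTheory Set Filter Topology
open Literature.MathematicalPhysics.KineticTheory.HeatConduction

/-- **Uniqueness of the bulk current autocorrelation.** For the pinned chain (`ω₂, lam, β > 0`) at `T > 0`, any two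
shift-invariant DLR states coincide, and any two dynamics preserving them have the same summed current autocorrelation
`C_T` at every time (DLR uniqueness in the shift-invariant class + a.e. rigidity of the flow towards the canonical
Buttà–Marchioro dynamics). [cite: Georgii2011, Thm 10.25 and §11.1] [cite: ButtaMarchioro2016, §2 Thm 2.1, eq. (2.6)] -/
theorem currentCorrelation_eq_of_isShiftInvariant {ω₂ lam β : ℝ} (γ : ℝ) (hω : 0 < ω₂) (hl : 0 < lam)
    (hβ : 0 < β) {T : ℝ} (hT : 0 < T) {μ₁ μ₂ : Measure ChainConfig}
    (h₁ : (pinnedChain ω₂ lam β γ).IsChainGibbsMeasure T μ₁) (hs₁ : IsShiftInvariant μ₁)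
    (h₂ : (pinnedChain ω₂ lam β γ).IsChainGibbsMeasure T μ₂) (hs₂ : IsShiftInvariant μ₂)
    (D₁ D₂ : InfiniteChainDynamics (pinnedChain ω₂ lam β γ))
    (hP₁ : D₁.PreservesMeasure μ₁) (hP₂ : D₂.PreservesMeasure μ₂) :
    μ₁ = μ₂ ∧ ∀ t : ℝ, D₁.currentCorrelation μ₁ t = D₂.currentCorrelation μ₂ t := by
  have hμ : μ₁ = μ₂ :=
    OscillatorChain.pinnedChain_eq_of_isChainGibbsMeasure_of_isShiftInvariant γ hω hl.le hβ.le hT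
      h₁ hs₁ h₂ hs₂
  subst hμ
  refine ⟨rfl, fun t => ?_⟩
  -- the canonical Buttà–Marchioro dynamics (carrier `bmGood`)
  obtain ⟨D', hcar, -⟩ :=
    OscillatorChain.exists_bmDynamics (P := pinnedChain ω₂ lam β γ) one_le_two one_le_two
      (OscillatorChain.pinnedChain_isEvenPolyOfDegree_U β γ hω.le hl)
      (OscillatorChain.pinnedChain_isEvenPolyOfDegree_V ω₂ lam γ hβ)
  -- rigidity: both flows are the canonical one a.e., at all times
  have hr₁ :=
    Summit.AtomisticToContinuum.FouriersLaw.Theorems.HeatVarianceCalculus.CanonicalRigidity.flow_ae_eq_canonical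
      γ hω hl hβ hT h₁ hs₁ D₁ D' hP₁ hcar
  have hr₂ :=
    Summit.AtomisticToContinuum.FouriersLaw.Theorems.HeatVarianceCalculus.CanonicalRigidity.flow_ae_eq_canonical
      γ hω hl hβ hT h₁ hs₁ D₂ D' hP₂ hcar
  unfold InfiniteChainDynamics.currentCorrelation
  refine tsum_congr fun x => integral_congr_ae ?_
  filter_upwards [hr₁, hr₂] with σ hσ₁ hσ₂
  rw [hσ₁ t, hσ₂ t]

/-- **M2 for every regular pair from ONE shift-invariant Abel witness.** If at every parameter point and `T > 0` some
shift-invariant DLR state with some preserving dynamics has convergent Abel means of its current autocorrelation, then the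
registered stub `stub_bulkAbelRegularPair` holds verbatim (the regular pair's correlation IS that function). [folklore] -/
theorem bulkAbelRegularPair_of_shiftInvariantWitness
    (hW : ∀ ω₂ lam β γ : ℝ, 0 < ω₂ → 0 < lam → 0 < β → 0 < γ → ∀ T : ℝ, 0 < T →
      ∃ (μT : Measure ChainConfig) (D' : InfiniteChainDynamics (pinnedChain ω₂ lam β γ)) (Λ : ℝ),
        (pinnedChain ω₂ lam β γ).IsChainGibbsMeasure T μT ∧ IsShiftInvariant μT ∧ D'.PreservesMeasure μT ∧
        Tendsto (fun ν : ℝ => ∫ t in Ioi (0:ℝ), Real.exp (-(ν * t)) * D'.currentCorrelation μT t)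
          (𝓝[>] 0) (𝓝 Λ)) :
    ∀ ω₂ lam β γ : ℝ, 0 < ω₂ → 0 < lam → 0 < β → 0 < γ → ∀ T : ℝ, 0 < T → ∀ (μT : MeasureTheory.Measure Literature.MathematicalPhysics.KineticTheory.HeatConduction.ChainConfig) (D : Literature.MathematicalPhysics.KineticTheory.HeatConduction.InfiniteChainDynamics (Literature.MathematicalPhysics.KineticTheory.HeatConduction.pinnedChain ω₂ lam β γ)), (Literature.MathematicalPhysics.KineticTheory.HeatConduction.pinnedChain ω₂ lam β γ).IsChainGibbsMeasure T μT → Literature.MathematicalPhysics.KineticTheory.HeatConduction.IsShiftInvariant μT → (Literature.MathematicalPhysics.KineticTheory.HeatConduction.pinnedChain ω₂ lam β γ).HasSuperstabilityEstimate μT → D.carrier ⊆ (Literature.MathematicalPhysics.KineticTheory.HeatConduction.pinnedChain ω₂ lam β γ).bmGood → D.PreservesMeasure μT → (∀ t : ℝ, D.HasAbsConvergentCorrelation μT t) → ∃ Λ : ℝ, Filter.Tendsto (fun ν : ℝ => ∫ t in Set.Ioi (0:ℝ), Real.exp (-(ν * t)) * D.currentCorrelation μT t) (nhdsWithin (0:ℝ)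 (Set.Ioi 0)) (nhds Λ) := by
  intro ω₂ lam β γ hω hl hβ hγ T hT μT D hG hS _hss _hcar hP _hAC
  obtain ⟨μ₀, D₀, Λ, hG₀, hS₀, hP₀, hΛ⟩ := hW ω₂ lam β γ hω hl hβ hγ T hT
  obtain ⟨-, hC⟩ := currentCorrelation_eq_of_isShiftInvariant γ hω hl hβ hT hG₀ hS₀ hG hS D₀ D hP₀ hP
  refine ⟨Λ, ?_⟩
  have e : (fun ν : ℝ => ∫ t in Set.Ioi (0:ℝ), Real.exp (-(ν * t)) * D.currentCorrelation μT t) =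
      fun ν : ℝ => ∫ t in Set.Ioi (0:ℝ), Real.exp (-(ν * t)) * D₀.currentCorrelation μ₀ t := by
    simp_rw [hC]
  rw [e]
  exact hΛ

/-- **M2 from the item `LatticeLandauDamping.AbelGreenKubo` (stmt-AtomisticToContinuum-14010) and the witness seam SI**
(`stub_witnessShiftInvariant` of Cruxes/AbelThermodynamicLimit/Lines/SketchIdeator2.lean, verbatim as `hSI`): the
`AbelGreenKubo` witness, moved onto a shift-invariant DLR state by SI, has Abel means `→ T²κ`; by
`currentCorrelation_eq_of_isShiftInvariant` every regular pair has the same correlation, hence the same limit. [folklore] -/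
theorem stub_bulkAbelRegularPairOfAbelGreenKubo :
    Summit.AtomisticToContinuum.FouriersLaw.Theses.LatticeLandauDamping.AbelGreenKubo →
    (∀ ω₂ lam β γ : ℝ, 0 < ω₂ → 0 < lam → 0 < β → 0 < γ → ∀ T : ℝ, 0 < T → (∃ (μT : MeasureTheory.Measure Literature.MathematicalPhysics.KineticTheory.HeatConduction.ChainConfig) (D' : Literature.MathematicalPhysics.KineticTheory.HeatConduction.InfiniteChainDynamics (Literature.MathematicalPhysics.KineticTheory.HeatConduction.pinnedChain ω₂ lam β γ)) (κ : ℝ), (Literature.MathematicalPhysics.KineticTheory.HeatConduction.pinnedChain ω₂ lam β γ).IsChainGibbsMeasure T μT ∧ D'.PreservesMeasure μT ∧ (∀ t : ℝ, D'.HasAbsConvergentCorrelation μT t) ∧ 0 < κ ∧ Filter.Tendsto (fun ν : ℝ => (T ^ 2)⁻¹ * MeasureTheory.integral (MeasureTheory.volume.restrict (Set.Ioi (0:ℝ))) (fun t : ℝ => Real.exp (-(ν * t)) * D'.currentCorrelation μT t)) (nhdsWithin (0:ℝ) (Set.Ioi 0)) (nhds κ)) → ∃ (μT : MeasureTheory.Measure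 Literature.MathematicalPhysics.KineticTheory.HeatConduction.ChainConfig) (D' : Literature.MathematicalPhysics.KineticTheory.HeatConduction.InfiniteChainDynamics (Literature.MathematicalPhysics.KineticTheory.HeatConduction.pinnedChain ω₂ lam β γ)) (κ : ℝ), (Literature.MathematicalPhysics.KineticTheory.HeatConduction.pinnedChain ω₂ lam β γ).IsChainGibbsMeasure T μT ∧ Literature.MathematicalPhysics.KineticTheory.HeatConduction.IsShiftInvariant μT ∧ D'.PreservesMeasure μT ∧ (∀ t : ℝ, D'.HasAbsConvergentCorrelation μT t) ∧ 0 < κ ∧ Filter.Tendsto (fun ν : ℝ => (T ^ 2)⁻¹ * MeasureTheory.integral (MeasureTheory.volume.restrict (Set.Ioi (0:ℝ))) (fun t : ℝ => Real.exp (-(ν * t)) * D'.currentCorrelation μT t)) (nhdsWithin (0:ℝ) (Set.Ioi 0)) (nhds κ)) →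
    ∀ ω₂ lam β γ : ℝ, 0 < ω₂ → 0 < lam → 0 < β → 0 < γ → ∀ T : ℝ, 0 < T → ∀ (μT : MeasureTheory.Measure Literature.MathematicalPhysics.KineticTheory.HeatConduction.ChainConfig) (D : Literature.MathematicalPhysics.KineticTheory.HeatConduction.InfiniteChainDynamics (Literature.MathematicalPhysics.KineticTheory.HeatConduction.pinnedChain ω₂ lam β γ)), (Literature.MathematicalPhysics.KineticTheory.HeatConduction.pinnedChain ω₂ lam β γ).IsChainGibbsMeasure T μT → Literature.MathematicalPhysics.KineticTheory.HeatConduction.IsShiftInvariant μT → (Literature.MathematicalPhysics.KineticTheory.HeatConduction.pinnedChain ω₂ lam β γ).HasSuperstabilityEstimate μT → D.carrier ⊆ (Literature.MathematicalPhysics.KineticTheory.HeatConduction.pinnedChain ω₂ lam β γ).bmGood → D.PreservesMeasure μT → (∀ t : ℝ, D.HasAbsConvergentCorrelation μT t) → ∃ Λ : ℝ, Filter.Tendsto (fun ν : ℝ => ∫ t in Set.Ioi (0:ℝ), Real.exp (-(ν * t)) * D.currentCorrelation μT t) (nhdsWithin (0:ℝ) (Set.Ioi 0)) (nhds Λ)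 := by
  intro hAGK hSI
  refine bulkAbelRegularPair_of_shiftInvariantWitness fun ω₂ lam β γ hω hl hβ hγ T hT => ?_
  obtain ⟨μT, D', κ, hG, hS, hP, -, -, hκ⟩ :=
    hSI ω₂ lam β γ hω hl hβ hγ T hT (hAGK ω₂ lam β γ hω hl hβ hγ T hT)
  refine ⟨μT, D', T ^ 2 * κ, hG, hS, hP, ?_⟩
  have hT2 : T ^ 2 ≠ 0 := by positivity
  have h := hκ.const_mul (T ^ 2)
  simp only [← mul_assoc, mul_inv_cancel₀ hT2, one_mul] at h
  exact h

/-- **M2 from the items `LatticeLandauDamping.WindowDecomposition` (stmt-14011) ∧ `NoDrudeWeight` (stmt-14012), NO seam.**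
The window decomposition supplies a SHIFT-INVARIANT DLR state, a preserving dynamics and a spectral measure `σ` with
`C_T = ∫cos(ωt)dσ` and `σ|(−δ,δ) = σ{0}δ₀ + g dω`, `g` continuous `≥ 0`; `NoDrudeWeight` kills the atom; the landed
Poisson-kernel lemma (`latticeLandauDamping_abelOfSpectralDensity_proof`, stmt-12598) gives Abel means `→ πg(0)`
(positivity of `g 0`, i.e. `PositiveDensity`, is NOT needed for existence); then `bulkAbelRegularPair_of_shiftInvariantWitness`.
[folklore] -/
theorem stub_bulkAbelRegularPairOfWindow :
    Summit.AtomisticToContinuum.FouriersLaw.Theses.LatticeLandauDamping.WindowDecomposition →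
    Summit.AtomisticToContinuum.FouriersLaw.Theses.LatticeLandauDamping.NoDrudeWeight →
    ∀ ω₂ lam β γ : ℝ, 0 < ω₂ → 0 < lam → 0 < β → 0 < γ → ∀ T : ℝ, 0 < T → ∀ (μT : MeasureTheory.Measure Literature.MathematicalPhysics.KineticTheory.HeatConduction.ChainConfig) (D : Literature.MathematicalPhysics.KineticTheory.HeatConduction.InfiniteChainDynamics (Literature.MathematicalPhysics.KineticTheory.HeatConduction.pinnedChain ω₂ lam β γ)), (Literature.MathematicalPhysics.KineticTheory.HeatConduction.pinnedChain ω₂ lam β γ).IsChainGibbsMeasure T μT → Literature.MathematicalPhysics.KineticTheory.HeatConduction.IsShiftInvariant μT → (Literature.MathematicalPhysics.KineticTheory.HeatConduction.pinnedChain ω₂ lam β γ).HasSuperstabilityEstimate μT → D.carrier ⊆ (Literature.MathematicalPhysics.KineticTheory.HeatConduction.pinnedChain ω₂ lam β γ).bmGood → D.PreservesMeasure μT → (∀ t : ℝ, D.HasAbsConvergentCorrelation μT t) → ∃ Λ : ℝ, Filter.Tendsto (fun ν : ℝ => ∫ t in Set.Ioi (0:ℝ), Real.exp (-(ν * t)) *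 D.currentCorrelation μT t) (nhdsWithin (0:ℝ) (Set.Ioi 0)) (nhds Λ) := by
  intro hWD hND
  refine bulkAbelRegularPair_of_shiftInvariantWitness fun ω₂ lam β γ hω hl hβ hγ T hT => ?_
  obtain ⟨μT, D, hGibbs, hshift, hpres, habs, σ, hfin, hC, δ, g, hδ, hg, hg0, hres⟩ :=
    hWD ω₂ lam β γ hω hl hβ hγ T hT
  -- no Drude weight: the atom at frequency `0` vanishes
  have h0 : σ {0} = 0 := hND ω₂ lam β γ hω hl hβ hγ T hT μT D hGibbs hshift hpres habs σ hfin hC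
  rw [h0, zero_smul, zero_add] at hres
  -- the Poisson-kernel lemma: Abel means of `C_T` converge to `π·g 0`
  have hlim :=
    Summit.AtomisticToContinuum.FouriersLaw.Theorems.AbelOfSpectralDensity.latticeLandauDamping_abelOfSpectralDensity_proof
      σ (D.currentCorrelation μT) δ g hfin hδ hC hg hg0 hres
  -- the unit lattice translation is `shift`
  have hS : IsShiftInvariant μT := (hshift 1).map_eq
  exact ⟨μT, D, Real.pi * g 0, hGibbs, hS, hpres, hlim⟩

end Summit.AtomisticToContinuum.FouriersLaw.Theorems.UniformAbelianRegularity.ZeroMeanDyadicSplice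

end
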